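import Literature.MathematicalPhysics.QuantumFieldTheory.Balaban1983to89.B13TermWalkDataOneTorus
import Summits.QuantumFields.BalabanUV.T4Continuum.Spine.NE5.TwoRunTorusPrimitiveParam
import Summits.QuantumFields.BalabanUV.T4Continuum.Spine.NE5.TwoRunTorusWalkH226

/-!
# Spine/NE5/TwoRunTorusWalkParam — the torus chain's two inputs (`hPhol`, `h226`) for ONE term along ANY parameter,
# with the walk-road letters READ BY NAME from ONE `B13TermWalkData` record at `c⁺` (cell `pub-balaban-gaps`, seat `ne5` gen 9;
# v1.2 gen 10: the (J1) glue lemma `sigma_region_glue` is REUSED from T31 `TwoRunTorusWalkH226`, not restated)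

WHY.  T21 `TwoRunTorusPrimitiveParam.hol_and_h226_torus_of_primitives_param` derives, for one (2.14)-term of the
two-scale torus model and ANY complex parameter `b ∈ V` (NE5: the two-run pencil, `B = E × ℂ`; (D4): the background
seam), BOTH inputs of the torus chain — holomorphy of the term in `b` and (2.26) uniformly in `b` — from PRIMITIVE
data: the precision `A b σ`, the Γ-kernel `G b σ`, the potentials, the common small-field functions, and a list of
located letters uniform in `b`.  Nine of its binders are exactly what the (D4) walk road produces for a term: the
localisation letters `hG hΓ₀ hCs hC216` (= `B13PrimitiveKernels216.Localisation17a`), the (2.16)-type differences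
`hdΓ hdC hdE` (= `Differences216`) and the entrywise holomorphy IN THE PARAMETER `hAholb hGholb`
(= `B13JointWalkExpansion.AnalyticOnBall`) — all three delivered from ONE record `𝒦 : B13TermWalkData.TermKernels`
with `TermWalkData 𝒦 w` by the landed capstones `localisation17a_of_termWalkData`, `differences216_of_termWalkData`,
`JointWalkExpansion.analyticOnBall`.  The only mismatch was located as junction (J1) (`HOME/ne/NE5.md` §14): the
walk road states its letters on the CLOSED polydisc `‖σ_j‖ ≤ e^{κ₁}` while the (2.14)∕Cauchy layer wants an OPEN
σ-region containing it; CLOSED at zero cost by the cell's word of 2026-08-23 (g1-plan-1 GEN 19, lit-balaban r10 g35):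
run the walk road at `c⁺ := {c with κ₁ := c.κ₁ + 1}` ([II] p. 5 «κ₁ is a sufficiently big positive number») and
let the consumer take `Uσ := ball 0 e^{κ₁+1}` — no variant theorem on either side.  THIS FILE executes that word as
ONE theorem: `hol_and_h226_torus_of_termWalkData_param` = T21 §2 with the nine binders discharged from a
`TermKernels c⁺` record over the parameter space `B` and `V := ball 0 α` (`α` the admissible configuration size,
`α < w.R`).  What REMAINS a hypothesis per term is then legible: entrywise σ-holomorphy of `𝒦.A2 σ b`, `𝒦.G2 σ b`
(the operators are built from σ by the linear interpolations (2.4)–(2.6) — NODE O, not walk data), symmetry and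
`Re ≻ 0` of the precision on the closed `c⁺`-polydisc × the closed `α`-ball ([II] p. 15 — NODE A), the potentials
`𝐕 b Y` with (2.20) on the per-domain τ-regions uniformly in `b` (the history channel, [II] (1.36)∕(1.43)), the common
`χ, χᶜ, 𝐃` with (2.22) (located typing point (x9): the cut sits on the Gaussian variable, [II] (2.3)∕(2.22)), a fibre
bound for the column locations, and the p. 17 numerics — with the letters now the record's constants
`(K̄_Γ, K̄_Γ, K̄_C, K̄_C)` and the derived `θ_Γ = 2K̄_Γe^{−εR_σ} + 2K̄_Γα∕R`, `θ_E = 2K̄_Ee^{−εR_σ} + 2K̄_Eα∕R`,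
`θ_C = K̄_C·θ_E·(m(1+2∕(κ−κ_a)))^ν·K̄_C·(m(1+2∕(κ_a−κ_b)))^ν` (print's `O(1)e^{−⅓δ₀M} + O(α₀ + α₁)`).  For NE5's pencil
the record is T18 `TwoRunPencilParametrix.termWalkData_pencil` ∕ T19 `TwoRunPencilFullModel.termWalkData_pencil` on
NODE O's model terms (parameter space `E × ℂ`); for (D4)'s seam it is g1-p2's `termWalkData_parametrix` ∕
`FullModelTerm.termWalkData` (parameter space `E`).

HONEST FRAMING.  Pure composition of LANDED shapes (T21 §2; `B13TermWalkData` §2 capstones; `B13PrimitiveKernels216`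
rate monotonicity); every record, region, list, function and number is a HYPOTHESIS; nothing of Bałaban's
`C^{(k)}(Z₀,σ)`, `Γ_k(Z₀,σ)`, `𝐕_k` is constructed or asserted; whether Bałaban's operators admit `TermWalkData` with
printed constants is NODE O's statement (v), not claimed here; NE5 NOT PRINTED ∕ NOT PROVED; leaves 0∕12; (D4) 0∕1;
spine 0∕9.  Rung (B)+1 on a FIXED finite T⁴ — NOT continuum, NOT infinite volume, NOT mass gap, NOT Clay.  HONEST
DEPENDENCY: continuum YM on T⁴ ⇐ BetaPertH ∧ nine spine estimates; BetaPertH ⇐ (D1) ∧ (D4) ∧ CAP+tail.  0 sorry, 0 `def`.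

Sources: [II] = T. Bałaban, CMP **116** (1988) 1–22 [Balaban1988RG2Cluster] p. 5 (κ₁), p. 13, (2.14)–(2.16) pp. 15–16,
(2.20)–(2.26) pp. 16–17; [B9] = CMP **99** (1985) [Balaban1985BackgroundPropagators] Thm 3.10 p. 416; C. King, CMP **102**
(1986) [King1986] p. 665.  Nothing here is a claim about the Yang–Mills mass gap.
-/

noncomputable section

namespace Summit.QuantumFields.BalabanUV.T4Continuum.Spine.NE5.TwoRunTorusWalkParam

open Matrix Metric Set Finset
open Literature.MathematicalPhysics.QuantumFieldTheory.Balaban1983to89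
open Literature.MathematicalPhysics.QuantumFieldTheory.Balaban1983to89.TreeLengthTorus (TPt TDom tsys)
open Literature.MathematicalPhysics.QuantumFieldTheory.Balaban1983to89.TreeLengthTorusTransfer (tclosure)
open Literature.MathematicalPhysics.QuantumFieldTheory.Balaban1983to89.B13Lemma3TorusData (TBond)
open Literature.MathematicalPhysics.QuantumFieldTheory.Balaban1983to89.B13Lemma3TorusTerms (weight Z0)
open Literature.MathematicalPhysics.QuantumFieldTheory.Balaban1983to89.B13Term214 (core214 F214 term214)
open Literature.MathematicalPhysics.QuantumFieldTheory.Balaban1983to89.B13Bound143 (invTau)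
open Literature.MathematicalPhysics.QuantumFieldTheory.Balaban1983to89.B5TorusCover (UT)
open Literature.MathematicalPhysics.QuantumFieldTheory.Balaban1983to89.B9Thm37GlueTorus (tdist1)
open Literature.MathematicalPhysics.QuantumFieldTheory.Balaban1983to89.B13PrimitiveKernels216
  (Localisation17a Differences216 localisation17a_mono_rate)
open Literature.MathematicalPhysics.QuantumFieldTheory.Balaban1983to89.B13TermWalkData
  (WalkConsts TermKernels TermWalkData localisation17a_of_termWalkData differences216_of_termWalkData)
open Literature.MathematicalPhysics.QuantumFieldTheory.Balaban1983to89.B13TermWalkDataOneTorus (SmallTheta)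
open Summit.QuantumFields.BalabanUV.T4Continuum.Spine.NE5.TwoRunTorusPrimitiveParam
  (hol_and_h226_torus_of_primitives_param)
open Summit.QuantumFields.BalabanUV.T4Continuum.Spine.NE5.TwoRunTorusWalkH226 (sigma_region_glue)

variable {d L N' : ℕ} [NeZero L] [NeZero N'] {M : ℕ}
variable {ν : ℕ} {Nf : Fin ν → ℕ} [∀ i, NeZero (Nf i)]
variable {B : Type*} [NormedAddCommGroup B] [NormedSpace ℂ B]

open Classical in
/-- **`hPhol` AND `h226` FOR ONE TERM OF THE TORUS MODEL ALONG ANY PARAMETER, THE WALK-ROAD LETTERS READ BY NAME FROM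
ONE `TermWalkData` RECORD AT `c⁺`.**  Data: the physical constants `c` (contour radius, (2.18) radii, weights), a term
`(Z, t)` with its lists, per-domain τ-regions; ONE kernel record `𝒦 : TermKernels c⁺ d N' ν Nf B` of the term over the
parameter space `B` (joint precision `𝒦.A2 σ b`, Γ-kernel `𝒦.G2 σ b`, real references `𝒦.Γ₀`, `𝒦.C ≻ 0`, bond locations,
σ-region `𝒦.X`) with walk objects `TermWalkData 𝒦 w` for a package `w` admissible at configuration size `α > 0`
(`α < w.R`) — THIS DISCHARGES T21's `hG hΓ₀ hCs hC216 hdΓ hdC hdE hAholb hGholb`; the Γ-operator `Γ b σ` linear with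
kernel `𝒦.G2 σ b`; entrywise σ-holomorphy of `𝒦.A2 · b`, `𝒦.G2 · b` on the open polydisc of radius `e^{κ₁+1}`;
symmetry and `Re ≻ 0` of `𝒦.A2 σ b` on the closed `c⁺`-polydisc for `‖b‖ ≤ α`; potentials `𝐕 b Y` holomorphic in `b`,
measurable, with (2.20) on `Π_Y Uτ Y` uniformly in `b ∈ ball 0 α`; common `χ, χᶜ, 𝐃` with (2.22); a column fibre bound;
rates `w.κ > κ_a > κ_b > κ′ > κ″ > 0`; NODE A's smallness `SmallTheta w α θ` BY NAME (`θ_Γ, θ_E ≤ θ`); and T21's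
remaining numerics stated for the record's letters `(K̄_Γ, K̄_Γ, K̄_C, K̄_C)` and the derived `(θ_Γ, θ_C, θ_E)` of
`differences216_of_termWalkData`.  Conclusion: on `V := ball 0 α`, (1) `b ↦ term214 r lZ lD
(core214 (𝒦.A2 · b) (Γ b) (F214 |P| χ χᶜ 𝐃 (𝐕 b))) 0 0` is `DifferentiableOn ℂ` — the input `hPhol` of T14
`TwoRunTorusRate.norm_E_sub_le_torus` (`B = ℂ`) ∕ T17 `TwoRunTorusParam.differentiableOn_E_torus_param`; (2) (2.26) for
every `b ∈ V` — their input `h226`.  Proof: T21 §2 at `Uσ := ball 0 e^{κ₁+1}` fed by `localisation17a_of_termWalkData`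
(dropped to rate `κ_b`), `differences216_of_termWalkData`, `JointWalkExpansion.analyticOnBall`.
[cite: Balaban1988RG2Cluster, p.5, p.13, (2.14)–(2.16) pp.15–16, (2.20)–(2.26) pp.16–17; Balaban1985BackgroundPropagators, Thm 3.10 p.416; King1986, p.665] -/
theorem hol_and_h226_torus_of_termWalkData_param (c : B13.Consts) (hκ₁ : 1 ≤ c.κ₁) (hα₆ : c.α₆ ≠ 0)
    (Z : TDom d N') (t : Finset (TDom d (L * N')) × Finset (TBond d M (L * N')))
    (hpos : ∀ Y : TDom d (L * N'), 0 < invTau c ((tsys d (L * N')).dj Y))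
    (hhalf : ∀ Y : TDom d (L * N'), invTau c ((tsys d (L * N')).dj Y) ≤ 1 / 2)
    {Uτ : TDom d (L * N') → Set ℂ} (hUτ : ∀ Y, IsOpen (Uτ Y))
    (hUtau : ∀ Y : TDom d (L * N'), closedBall (0 : ℂ) ((invTau c ((tsys d (L * N')).dj Y))⁻¹) ⊆ Uτ Y)
    {r : ℝ} (hr : 0 < r) (hr' : r ≤ Real.exp c.κ₁ - 1)
    (hsubτ : ∀ Y, ∀ s ∈ Set.uIcc (0 : ℝ) 1, closedBall (s : ℂ) r ⊆ Uτ Y)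
    (lZ : List (TPt d N')) (hlZ : lZ.Nodup ∧ lZ.toFinset = Z.1 \ tclosure L N' (Z0 M t))
    (lD : List (TDom d (L * N'))) (hlD : lD.Nodup ∧ lD.toFinset = t.1)
    -- THE WALK RECORD OF THE TERM AT `c⁺` OVER THE PARAMETER SPACE (the (D4) walk road's objects, g1-p2's record)
    (𝒦 : TermKernels ({ c with κ₁ := c.κ₁ + 1 } : B13.Consts) d N' ν Nf B) [Fintype 𝒦.C₀] [DecidableEq 𝒦.C₀]
    {w : WalkConsts} {α Rσ₀ : ℝ} (hw : w.Admissible α Rσ₀) (hα : 0 < α) (h𝒦 : TermWalkData 𝒦 w)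
    (Γ : B → (TPt d N' → ℂ) → (𝒦.Λ ⊕ 𝒦.C₀ → ℝ) → (𝒦.Λ → ℂ))
    (hlin : ∀ b ∈ ball (0 : B) α, ∀ σ : TPt d N' → ℂ, (∀ j, σ j ∈ ball (0 : ℂ) (Real.exp (c.κ₁ + 1))) →
      ∀ X : 𝒦.Λ ⊕ 𝒦.C₀ → ℝ, Γ b σ X = 𝒦.G2 σ b *ᵥ fun j => (X j : ℂ))
    (χY₀ χcP : (𝒦.Λ → ℝ) → ℝ) (hχ0 : ∀ Bf, 0 ≤ χY₀ Bf) (hχc0 : ∀ Bf, 0 ≤ χcP Bf) (Dfam : Finset (TDom d (L * N')))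
    (Vk : B → TDom d (L * N') → (𝒦.Λ → ℝ) → ℂ)
    -- what is NOT walk data: σ-holomorphy (NODE O), symmetry ∕ `Re ≻ 0` (NODE A), potentials (history channel)
    (hAhol : ∀ b ∈ ball (0 : B) α, ∀ i j,
      DifferentiableOn ℂ (fun σ => 𝒦.A2 σ b i j) {σ | ∀ j, σ j ∈ ball (0 : ℂ) (Real.exp (c.κ₁ + 1))})
    (hGhol : ∀ b ∈ ball (0 : B) α, ∀ i j,
      DifferentiableOn ℂ (fun σ => 𝒦.G2 σ b i j) {σ | ∀ j, σ j ∈ ball (0 : ℂ) (Real.exp (c.κ₁ + 1))})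
    (hVholb : ∀ Y Bf, DifferentiableOn ℂ (fun b => Vk b Y Bf) (ball (0 : B) α))
    (hχm : Measurable χY₀) (hχcm : Measurable χcP) (hVm : ∀ b ∈ ball (0 : B) α, ∀ Y, Measurable (Vk b Y))
    (hAs : ∀ b : B, ‖b‖ ≤ α → ∀ σ : TPt d N' → ℂ, (∀ j, ‖σ j‖ ≤ Real.exp (c.κ₁ + 1)) → (𝒦.A2 σ b).IsSymm)
    (hA : ∀ b : B, ‖b‖ ≤ α → ∀ σ : TPt d N' → ℂ, (∀ j, ‖σ j‖ ≤ Real.exp (c.κ₁ + 1)) →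
      ((𝒦.A2 σ b).map Complex.re).PosDef)
    -- the (2.22) shape, and (2.20) on the open PER-DOMAIN τ-region, uniform in `b`
    {γ₂ rP a₂₀ w₂₀ : ℝ} (qP : (𝒦.Λ → ℝ) → ℝ)
    (h222 : ∀ Bf, χY₀ Bf * χcP Bf ≤ Real.exp (-(γ₂ / 2 * rP ^ 2 * (t.2.card : ℕ)) + γ₂ / 2 * qP Bf))
    (hγ₂ : 0 ≤ γ₂) (hqP : ∀ Bf, qP Bf ≤ Bf ⬝ᵥ Bf) (ha0 : 0 ≤ a₂₀)
    (h220U : ∀ b ∈ ball (0 : B) α, ∀ τ : TDom d (L * N') → ℂ, (∀ Y, τ Y ∈ Uτ Y) →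
      ∀ Bf, ∑ Y ∈ Dfam, ‖τ Y‖ * ‖Vk b Y Bf‖ ≤ a₂₀ / 2 * (Bf ⬝ᵥ Bf) + w₂₀)
    -- a common fibre bound for row and column locations (`𝒦.hfib` bounds the rows by `𝒦.m`)
    {m : ℕ} (hm : 𝒦.m ≤ m) (hfibN : ∀ x : UT Nf, (Finset.univ.filter fun j => 𝒦.locN j = x).card ≤ m)
    -- rates: the record's torus rate `w.κ`, two drops for `Differences216`, two more for the (2.26) chain
    {κa κb kap' kap'' θ : ℝ} (hκa : κa < w.kap) (hκb : κb < κa) (h2 : kap' < κb) (h1 : kap'' < kap')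
    (hkap'' : 0 < kap'')
    -- NODE A's smallness BY NAME: `θ_Γ, θ_E ≤ θ` with `θ_• = 2K̄_•(e^{−εR_σ} + α∕R)` ((v)⁺ of `B13TermWalkDataOneTorus`)
    (hsm : SmallTheta w α θ)
    (hθR1le : (m * (1 + 2 / (κb - kap')) ^ ν) * (m * (1 + 2 / (kap' - kap'')) ^ ν)
      * ((2 * w.KbarΓ * Real.exp (-(w.ε * w.Rσ)) + 2 * w.KbarΓ * α / w.R) * w.KbarC * w.KbarΓ
        + w.KbarΓ * (w.KbarC * (2 * w.KbarE * Real.exp (-(w.ε * w.Rσ)) + 2 * w.KbarE * α / w.R)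
            * (𝒦.m * (1 + 2 / (w.kap - κa)) ^ ν) * w.KbarC * (𝒦.m * (1 + 2 / (κa - κb)) ^ ν)) * w.KbarΓ
        + w.KbarΓ * w.KbarC * (2 * w.KbarΓ * Real.exp (-(w.ε * w.Rσ)) + 2 * w.KbarΓ * α / w.R)) ≤ θ)
    (hsmallKθ : w.KbarC * (m * (1 + 2 / κb) ^ ν) * (θ * (m * (1 + 2 / kap'') ^ ν)) < 1)
    {cE g : ℝ} (hc0 : 0 ≤ cE) (hc : ∀ k, 𝒦.hC.1.eigenvalues k ≤ cE)
    (hαc : (2 * (θ * (m * (1 + 2 / kap'') ^ ν)) + (γ₂ + a₂₀)) * cE ≤ 1 / 2) (hg : 0 ≤ g)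
    (hΓq : ∀ X : 𝒦.Λ ⊕ 𝒦.C₀ → ℝ, (𝒦.Γ₀ *ᵥ X) ⬝ᵥ (𝒦.C *ᵥ (𝒦.Γ₀ *ᵥ X)) ≤ g * (X ⬝ᵥ X))
    (hsmall : (2 * (θ * (m * (1 + 2 / kap'') ^ ν)) + (γ₂ + a₂₀)) * (1 + 2 * cE * g) ≤ 1 / 2)
    {a a₅ : ℝ} (hPa : a ≤ γ₂ * rP ^ 2)
    (hvol : 2 * (w.KbarC * (m * (1 + 2 / κb) ^ ν) * (θ * (m * (1 + 2 / kap'') ^ ν))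
              * (1 + (1 - w.KbarC * (m * (1 + 2 / κb) ^ ν) * (θ * (m * (1 + 2 / kap'') ^ ν)))⁻¹) / 2)
          * (Fintype.card 𝒦.Λ : ℝ)
        + w₂₀ + (2 * (θ * (m * (1 + 2 / kap'') ^ ν)) + (γ₂ + a₂₀)) * cE * (Fintype.card 𝒦.Λ : ℝ)
        + (2 * (θ * (m * (1 + 2 / kap'') ^ ν)) + (γ₂ + a₂₀)) * (1 + 2 * cE * g) * (Fintype.card (𝒦.Λ ⊕ 𝒦.C₀) : ℝ)
        ≤ a₅ * ((Z.1).card : ℝ)) :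
    DifferentiableOn ℂ
        (fun b => term214 r lZ lD (core214 (fun σ => 𝒦.A2 σ b) (Γ b) (F214 t.2.card χY₀ χcP Dfam (Vk b))) 0 0)
        (ball (0 : B) α) ∧
      ∀ b ∈ ball (0 : B) α,
        ‖term214 r lZ lD (core214 (fun σ => 𝒦.A2 σ b) (Γ b) (F214 t.2.card χY₀ χcP Dfam (Vk b))) 0 0‖ ≤
          weight L M c Z a t * Real.exp (a₅ * ((Z.1).card : ℝ)) := by
  -- the (J1) glue: open σ-region of radius `e^{κ₁+1}` between the two closed polydiscs
  obtain ⟨hUσ, hUexp, hcl⟩ := sigma_region_glue (d := d) (N' := N') c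
  -- positivity of the rates and membership bookkeeping
  have hκb0 : 0 ≤ κb := (hkap''.trans (h1.trans h2)).le
  have hκbw : κb ≤ w.kap := (hκb.trans hκa).le
  have hbα : ∀ b ∈ ball (0 : B) α, ‖b‖ ≤ α := fun b hb => (mem_ball_zero_iff.1 hb).le
  have hbR : ∀ b ∈ ball (0 : B) α, b ∈ ball (0 : B) w.R := fun b hb => ball_subset_ball hw.hαR.le hb
  -- L17a at every member of the ball, at the record's rate, dropped to `κb`
  have h17 : ∀ b ∈ ball (0 : B) α, Localisation17a ({ c with κ₁ := c.κ₁ + 1 } : B13.Consts) (fun σ => 𝒦.A2 σ b)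
      (fun σ => 𝒦.G2 σ b) 𝒦.Γ₀ 𝒦.C 𝒦.locΛ 𝒦.locN κb w.KbarΓ w.KbarΓ w.KbarC w.KbarC := fun b hb =>
    localisation17a_mono_rate hκbw hw.hKbarΓ hw.hKbarΓ hw.hKbarC hw.hKbarC
      (localisation17a_of_termWalkData hw hα.le h𝒦 (hbR b hb))
  -- L16a at every member of the ball (symmetry ∕ `Re ≻ 0` are NODE A's inputs)
  have h16 : ∀ b ∈ ball (0 : B) α, Differences216 ({ c with κ₁ := c.κ₁ + 1 } : B13.Consts) (fun σ => 𝒦.A2 σ b)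
      (fun σ => 𝒦.G2 σ b) 𝒦.Γ₀ 𝒦.C 𝒦.locΛ 𝒦.locN κb
      (2 * w.KbarΓ * Real.exp (-(w.ε * w.Rσ)) + 2 * w.KbarΓ * α / w.R)
      (w.KbarC * (2 * w.KbarE * Real.exp (-(w.ε * w.Rσ)) + 2 * w.KbarE * α / w.R)
        * (𝒦.m * (1 + 2 / (w.kap - κa)) ^ ν) * w.KbarC * (𝒦.m * (1 + 2 / (κa - κb)) ^ ν))
      (2 * w.KbarE * Real.exp (-(w.ε * w.Rσ)) + 2 * w.KbarE * α / w.R) := fun b hb =>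
    differences216_of_termWalkData hw hα.le h𝒦 hκb0 hκb hκa (hbα b hb) (hAs b (hbα b hb)) (hA b (hbα b hb))
  -- entrywise holomorphy IN THE PARAMETER from the joint walk expansions ([B9] Thm 3.10, by name)
  obtain ⟨WΓ, TΓ, SXΓ, AΓ, DΓ, ρΓ, hΓw⟩ := h𝒦.hΓ
  obtain ⟨WE, TE, SXE, AE, DE, ρE, hEw⟩ := h𝒦.hE
  have hAholb : ∀ σ : TPt d N' → ℂ, (∀ j, σ j ∈ ball (0 : ℂ) (Real.exp (c.κ₁ + 1))) →
      ∀ i j, DifferentiableOn ℂ (fun b => 𝒦.A2 σ b i j) (ball (0 : B) α) := fun σ hσ i j =>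
    ((hEw.analyticOnBall hw.hε) σ (hcl σ hσ) i j).mono (ball_subset_ball hw.hαR.le)
  have hGholb : ∀ σ : TPt d N' → ℂ, (∀ j, σ j ∈ ball (0 : ℂ) (Real.exp (c.κ₁ + 1))) →
      ∀ i j, DifferentiableOn ℂ (fun b => 𝒦.G2 σ b i j) (ball (0 : B) α) := fun σ hσ i j =>
    ((hΓw.analyticOnBall hw.hε) σ (hcl σ hσ) i j).mono (ball_subset_ball hw.hαR.le)
  -- non-negativity of the derived letters
  have hR0 : 0 < w.R := hα.trans hw.hαR
  have hθΓ0 : 0 ≤ 2 * w.KbarΓ * Real.exp (-(w.ε * w.Rσ)) + 2 * w.KbarΓ * α / w.R := by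
    have := hw.hKbarΓ; positivity
  have hθE0 : 0 ≤ 2 * w.KbarE * Real.exp (-(w.ε * w.Rσ)) + 2 * w.KbarE * α / w.R := by
    have := hw.hKbarE; positivity
  have hθC0 : 0 ≤ w.KbarC * (2 * w.KbarE * Real.exp (-(w.ε * w.Rσ)) + 2 * w.KbarE * α / w.R)
      * (𝒦.m * (1 + 2 / (w.kap - κa)) ^ ν) * w.KbarC * (𝒦.m * (1 + 2 / (κa - κb)) ^ ν) := by
    have := hw.hKbarC; have := hw.hKbarE
    have h1' : 0 < w.kap - κa := sub_pos.2 hκa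
    have h2' : 0 < κa - κb := sub_pos.2 hκb
    positivity
  have hfibΛ : ∀ x : UT Nf, (Finset.univ.filter fun i => 𝒦.locΛ i = x).card ≤ m := fun x => (𝒦.hfib x).trans hm
  -- NODE A's smallness, unfolded to T21's two letters
  have hθEle : 2 * w.KbarE * Real.exp (-(w.ε * w.Rσ)) + 2 * w.KbarE * α / w.R ≤ θ :=
    (Eq.trans_le (by ring) hsm.hE)
  have hθΓle : 2 * w.KbarΓ * Real.exp (-(w.ε * w.Rσ)) + 2 * w.KbarΓ * α / w.R ≤ θ :=
    (Eq.trans_le (by ring) hsm.hΓ)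
  -- T21 §2 at the open region, every walk-road binder read from the record
  refine hol_and_h226_torus_of_primitives_param c hκ₁ hα₆ Z t hpos hhalf hUσ hUτ hUexp hUtau hr hr' hsubτ lZ hlZ lD
    hlD isOpen_ball (fun b σ => 𝒦.A2 σ b) Γ (fun b σ => 𝒦.G2 σ b) χY₀ χcP hχ0 hχc0 Dfam Vk 𝒦.hC 𝒦.Γ₀ hAhol hGhol
    hAholb hGholb hVholb hχm hχcm hVm (fun b hb σ hσ => hAs b (hbα b hb) σ (hcl σ hσ))
    (fun b hb σ hσ => hA b (hbα b hb) σ (hcl σ hσ)) hlin qP h222 hγ₂ hqP ha0 h220U 𝒦.locΛ 𝒦.locN hfibΛ hfibN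
    hkap'' h1 h2 hθE0 hθΓ0 hθC0 hw.hKbarΓ hw.hKbarΓ hw.hKbarC hw.hKbarC hθEle hθΓle hθR1le
    (fun b hb σ hσ => (h17 b hb).hG σ (hcl σ hσ)) (fun i j => ?_) (fun b hb σ hσ => (h17 b hb).hCs σ (hcl σ hσ))
    (fun i i' => ?_) (fun b hb σ hσ => (h16 b hb).hdΓ σ (hcl σ hσ)) (fun b hb σ hσ => (h16 b hb).hdC σ (hcl σ hσ))
    (fun b hb σ hσ => (h16 b hb).hdE σ (hcl σ hσ)) hsmallKθ hc0 hc hαc hg hΓq hsmall hPa hvol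
  · exact (h17 0 (mem_ball_self hα)).hΓ₀ i j
  · exact (h17 0 (mem_ball_self hα)).hC216 i i'

end Summit.QuantumFields.BalabanUV.T4Continuum.Spine.NE5.TwoRunTorusWalkParam

end
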